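import Literature.MathematicalPhysics.QuantumFieldTheory.Balaban1983to89.B5Eq172FlatCoercivity
import Literature.MathematicalPhysics.QuantumFieldTheory.Balaban1983to89.B9Eq315QFlatNorm

/-!
# `Balaban1983to89.B5Eq172FlatFibreNaturality` — T. Bałaban, *Propagators and renormalization transformations for lattice gauge theories. I*,
# Commun. Math. Phys. **95** (1984) 17–40 [Balaban1984PropagatorsI] (1.69)/(1.72) pp. 29–30 and Prop. 1.1 p. 33, against *Propagators for lattice
# gauge theories in a background field*, Commun. Math. Phys. **99** (1985) 389–434 [Balaban1985BackgroundPropagators] (3.3)–(3.26) pp. 390–395 AT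
# THE FLAT BACKGROUND: THE pub-balaban NE9 CHAIN'S FLAT LETTERS `D(1)`, `D*(1)`, `Δ^η_1`, `Q′(1)`, `Q(1)` AND THE PROJECTION `R(1)` COMMUTE WITH
# EVERY LINEAR MAP OF THE FIBRE — the `𝔤ᶜ`-valued flat operator is the scalar one, fibre coordinate by fibre coordinate

statement-level skeleton of published theorems with citation tags; proofs where landed; nothing here is a claim about the Yang–Mills mass gap

PDF held: `paper:balaban1984-cmp95-propagators-rt-i` p. 33 (Prop. 1.1, p0017 of the text layer) and pp. 29–30, read by this seat (2026-08-22);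
[Balaban1985BackgroundPropagators] (3.3)–(3.26) via the tree's `B9Eq33CovDerivVector` ∕ `B9Eq34CovCurlVector` ∕ `B9Eq319QprimeTorus` ∕ `B9Eq315QTorus`
docstrings (quoted there verbatim).

THE PRINT (verbatim).  [B5] p. 33: *«Proposition 1.1. The operator G is a symmetric operator on L²(T_η) and ‖GJ‖, ‖∇GJ‖, ‖G∇*J‖, ‖∇G∇*J‖,
‖∇∇GJ‖, ‖G∇*∇*J‖ ≤ γ₀⁻¹‖J‖, (1.89) with a positive constant γ₀ independent of k, T_η, and depending on d only (if we put a = 1). This implies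
the bound from below: Δ_a = G⁻¹ ≥ γ₀(Δ + I). (1.90)»* — a statement about SCALAR functions on the torus `T_η` (the components `A_μ`, p. 30
after (1.73): *«We consider A also as a vector valued function on the lattice T_η»*); [B9] p. 390: the fields of the background-field propagators
are `𝔤ᶜ`-valued and the derivatives (3.3)∕(3.4) carry the transporters `R(U(b))X = U(b)XU(b)⁻¹` — the identity at `U = 1`.

WHY THIS FILE (cell context).  The NE9 leaves made every constant of the OWNER's fixed-lattice [B9] Thm 3.11 second half
(`B9Thm311SmallFieldCoercivity.exists_coercive_principal_of_small_field`: `∃ γ ε₀ > 0, ∀ U small …`) explicit and volume-free EXCEPT the flat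
coercivity `γ₀`, still obtained by compactness (`B5Eq172FlatCoercivity.exists_coercive_principal_flat` via `exists_coercive_of_rePosDef`).  Print's
uniform constant is (1.90), a tree theorem on b05's SCALAR carrier (`B5DeltaA169.smul_LapOne_le_DeltaA`), transported to the chain's scalar letters
by `B5Eq190FlatFormTransfer`.  This file is the reduction of the `𝔤ᶜ`-valued flat form (Hilbert fibre `W`, algebra reading `φ : W ≃ 𝔸`) to the
scalar one: every flat letter commutes with post-composition by a linear map of the fibre, so that — by Parseval over an orthonormal basis of `W`,
`B5Eq190FlatCoercivityUniform` — the flat form of `x` is the sum of the scalar flat forms of its coordinates `⟨b_k, x(·)⟩`.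

WHAT IS PROVED (sorry-free; 0 `def`; no inequality of the papers).
* §1 `inner_coord_eq_inner_tensor` (the coordinate map `f ↦ ⟨u, f(·)⟩` and the tensor map `g ↦ g(·)•u` are ADJOINT between the weighted carriers
  `B9Eq311L2Pairing.WL2` of `W`-valued and of scalar functions), **`sum_norm_sq_coord`** (Parseval: `Σ_k ‖⟨b_k, f(·)⟩‖² = ‖f‖²`).
* §2 for EVERY `ℂ`-linear `ψ : V → V′` and any algebra readings `φ`, `φ′` of the two fibres: **`map_covCurlL2K_one`**, **`map_covDerivL2K_one`**,
  **`map_covDivL2K_one`**, **`map_covLaplaceSiteK_one`** — `ψ ∘ T(1) = T(1) ∘ ψ` for `T = D` (3.4), `D` (3.3), `D*` (3.8), `D*D` (3.23) at the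
  flat transporters (`B5Eq172HodgePositivity.adTransportW_one` ∕ `adTransportW_inv_one`).
* §3 **`map_QprimeW_one`** (`Q′(1)` = the plain block mean, `B5Eq155FlatAveragingCommute.QprimeW_one_apply`), **`equiv_QtorusW_one`** (`Q(1)` on
  the weighted carrier does not see `φ`: `B9Eq315QFlatNorm.QtorusLin_one_apply` conjugated by the linear `φ`), **`map_QtorusW_one`**.
* §4 **`map_projR_of_intertwine`** ([folklore] Hilbert-space lemma: the orthogonal projection `B11Eq103H1Complex.projR` onto `Δ N(Q)` commutes
  with an adjoint pair that intertwines the two `Δ`'s and the two kernels — Mathlib's `Submodule.eq_starProjection_of_mem_of_inner_eq_zero`) and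
  its instance **`coord_RofU_one`**: `⟨u, (R(1)v)(·)⟩ = R(1)⟨u, v(·)⟩` for the chain's `B9Eq326OperatorAssembly.RofU` at `U = 1` (the `W`-valued
  `R(1)` of any reading `φ` against the scalar one, `𝔸 = ℂ`, `φ = refl`); the coordinate corollaries `coord_covCurlL2K_one`, `coord_covDivL2K_one`,
  `coord_QtorusW_one` of §§2–3 at `ψ = ⟨u, ·⟩`.
MODEL / DECLARED READINGS.  (M1) the chain's encodings (`B11Eq103H1Complex.SiteL2K/BondL2K/covDerivL2K/covDivL2K/covLaplaceSiteK/projR`,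
`B9Eq310HessianOperator.covCurlL2K/adTransportW`, `B9Eq326OperatorAssembly.QprimeW/RofU`, `B9Eq315QTorus.QtorusW`) at `U ≡ 1`; the flat regularity
letters `hα1 ∕ hU1 ∕ hreg` of `QtorusW` FREE on both sides (inhabited by `B5Eq172FlatCoercivity.hU1_one/hreg_one`).  (M2) no hypothesis of the
papers displayed or used.  (M3) NOT HERE: the flat form identity, the transfer of (1.90), the coercivity constant (`B5Eq190FlatCoercivityUniform`);
backgrounds `U ≠ 1`.
HONEST SCOPE.  [folklore] linear algebra on the cell's own typed carriers of the printed lattice; nothing of (1.89)–(1.90) or [B9] Thm 3.11 is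
asserted; NOT summit progress (cell pub-balaban: NE9 NOT PRINTED ∕ NOT PROVED; «NE9 ⇐ the named binders»; spine PROVED 0/9; HONEST DEPENDENCY:
continuum YM on T⁴ ⇐ BetaPertH ∧ nine spine estimates (0/9 proved); BetaPertH ⇐ (D1) ∧ (D4) ∧ CAP+tail; G-an2-4 gates asym, D1 and NE2/3/4).  Unit
`b2b-balaban-t4-ne9-formalise-leaf-03` (NE9 crux-team leaf prover, gen 59), INTENT I-ne9leaf03-g59-1 item (N); NEW file importing
`B5Eq172FlatCoercivity` + `B9Eq315QFlatNorm`; modifies nothing.  Net new unproved facts: 0.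
-/

noncomputable section

open scoped BigOperators InnerProductSpace ComplexConjugate

namespace Literature.MathematicalPhysics.QuantumFieldTheory.Balaban1983to89.B5Eq172FlatFibreNaturality

open B4Sect5Torus (TSite)
open B9SectCLatticeCarrier (Bond)
open B9Eq311L2Pairing (WL2)
open B11Eq103H1Complex (SiteL2K BondL2K covDerivL2K covDivL2K covLaplaceSiteK projR laplaceALatticeK RLatticeK
  equiv_covDerivL2K equiv_covDivL2K exists_ker_projR_eq)
open B9Eq310HessianOperator (PlaqL2K adTransportW principalOpK covCurlL2K equiv_covCurlL2K)
open B9Eq33CovDerivVector (covDeriv_apply covDiv_apply)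
open B9Eq34CovCurlVector (covCurl_apply_coord)
open B5Eq172HodgePositivity (adTransportW_one adTransportW_inv_one)

variable {d : ℕ}

/-! ## §1 Fibre coordinates on the weighted `L²` carriers: the adjoint pair `⟨u, ·⟩` ∕ `(·)•u` and Parseval -/

section Coord

variable {X : Type*} [Fintype X] {w : X → ℝ} [Fact (∀ x, 0 < w x)]
  {W : Type*} [NormedAddCommGroup W] [InnerProductSpace ℂ W]

/-- **The coordinate map `f ↦ ⟨u, f(·)⟩` and the tensor map `g ↦ g(·)•u` are ADJOINT** between the weighted `L²` carriers of `W`-valued and of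
scalar functions (same weights): `⟨g, ⟨u, f(·)⟩⟩ = ⟨g(·)•u, f⟩`. [folklore] [cite: Balaban1985BackgroundPropagators, (3.11) p.392] -/
theorem inner_coord_eq_inner_tensor (u : W) (g : WL2 ℂ w ℂ) (f : WL2 ℂ w W) :
    ⟪g, (WL2.equiv ℂ w ℂ).symm (fun x => ⟪u, WL2.equiv ℂ w W f x⟫_ℂ)⟫_ℂ =
      ⟪(WL2.equiv ℂ w W).symm (fun x => WL2.equiv ℂ w ℂ g x • u), f⟫_ℂ := by
  rw [WL2.inner_def, WL2.inner_def]
  refine Finset.sum_congr rfl fun x _ => ?_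
  rw [Equiv.apply_symm_apply, Equiv.apply_symm_apply, inner_smul_left, RCLike.inner_apply, mul_comm (conj _)]

/-- **PARSEVAL ON THE WEIGHTED CARRIER**: for an orthonormal basis `b` of the fibre, `Σ_k ‖⟨b_k, f(·)⟩‖² = ‖f‖²`. [folklore]
[cite: Balaban1985BackgroundPropagators, (3.11) p.392] -/
theorem sum_norm_sq_coord {ι : Type*} [Fintype ι] (b : OrthonormalBasis ι ℂ W) (f : WL2 ℂ w W) :
    ∑ k, ‖(WL2.equiv ℂ w ℂ).symm (fun x => ⟪b k, WL2.equiv ℂ w W f x⟫_ℂ)‖ ^ 2 = ‖f‖ ^ 2 := by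
  simp only [WL2.norm_sq, Equiv.apply_symm_apply]
  rw [Finset.sum_comm]
  refine Finset.sum_congr rfl fun x _ => ?_
  rw [← Finset.mul_sum, b.sum_sq_norm_inner_right]

end Coord

/-! ## §2 The flat derivative letters commute with every linear map of the fibre -/

section FlatLetters

variable {P : Fin d → ℕ} {c₀ : ℝ} [Fact (0 < c₀)]
  {𝔸 : Type*} [Ring 𝔸] [Algebra ℂ 𝔸] {V : Type*} [NormedAddCommGroup V] [InnerProductSpace ℂ V] (φ : V ≃ₗ[ℂ] 𝔸)
  {𝔸' : Type*} [Ring 𝔸'] [Algebra ℂ 𝔸'] {V' : Type*} [NormedAddCommGroup V'] [InnerProductSpace ℂ V'] (φ' : V' ≃ₗ[ℂ] 𝔸')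
  (ψ : V →ₗ[ℂ] V') (c : ℂ)

/-- **THE FLAT CURL (3.4) IS NATURAL IN THE FIBRE**: for every `ℂ`-linear `ψ : V → V′`, `ψ ∘ D(1) = D(1) ∘ ψ` on bond functions
(identity transporters, `adTransportW_one`). [folklore] [cite: Balaban1985BackgroundPropagators, (3.4) p.391] -/
theorem map_covCurlL2K_one (A : BondL2K ℂ d P c₀ V) :
    (WL2.equiv ℂ _ V').symm (fun p => ψ (WL2.equiv ℂ _ V (covCurlL2K ℂ c₀ c (adTransportW φ (fun _ : Bond d P => (1 : 𝔸ˣ))) A) p)) =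
      covCurlL2K ℂ c₀ c (adTransportW φ' (fun _ : Bond d P => (1 : 𝔸'ˣ)))
        ((WL2.equiv ℂ _ V').symm fun b => ψ (WL2.equiv ℂ _ V A b)) := by
  apply (WL2.equiv ℂ (fun _ : B9SectCLatticeCarrier.Plaq d P => c₀) V').injective
  funext p
  obtain ⟨x, q⟩ := p
  rw [Equiv.apply_symm_apply, equiv_covCurlL2K, equiv_covCurlL2K, covCurl_apply_coord, covCurl_apply_coord, adTransportW_one,
    adTransportW_one, adTransportW_one, adTransportW_one]
  simp only [LinearMap.id_apply, map_sub, map_smul, Equiv.apply_symm_apply]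

/-- **THE FLAT DERIVATIVE (3.3) IS NATURAL IN THE FIBRE.** [folklore] [cite: Balaban1985BackgroundPropagators, (3.3) p.391] -/
theorem map_covDerivL2K_one (l : SiteL2K ℂ d P c₀ V) :
    (WL2.equiv ℂ _ V').symm (fun b => ψ (WL2.equiv ℂ _ V (covDerivL2K ℂ c₀ c (adTransportW φ (fun _ : Bond d P => (1 : 𝔸ˣ))) l) b)) =
      covDerivL2K ℂ c₀ c (adTransportW φ' (fun _ : Bond d P => (1 : 𝔸'ˣ)))
        ((WL2.equiv ℂ _ V').symm fun x => ψ (WL2.equiv ℂ _ V l x)) := by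
  apply (WL2.equiv ℂ (fun _ : Bond d P => c₀) V').injective
  funext b
  rw [Equiv.apply_symm_apply, equiv_covDerivL2K, equiv_covDerivL2K, covDeriv_apply, covDeriv_apply, adTransportW_one, adTransportW_one]
  simp only [LinearMap.id_apply, map_sub, map_smul, Equiv.apply_symm_apply]

/-- **THE FLAT DIVERGENCE (3.8) IS NATURAL IN THE FIBRE** (adjoint transporters `R(1⁻¹) = id`, `adTransportW_inv_one`). [folklore]
[cite: Balaban1985BackgroundPropagators, (3.8) p.392] -/
theorem map_covDivL2K_one (A : BondL2K ℂ d P c₀ V) :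
    (WL2.equiv ℂ _ V').symm (fun x => ψ (WL2.equiv ℂ _ V (covDivL2K ℂ c₀ c (adTransportW φ fun _ : Bond d P => (1 : 𝔸ˣ)⁻¹) A) x)) =
      covDivL2K ℂ c₀ c (adTransportW φ' fun _ : Bond d P => (1 : 𝔸'ˣ)⁻¹)
        ((WL2.equiv ℂ _ V').symm fun b => ψ (WL2.equiv ℂ _ V A b)) := by
  apply (WL2.equiv ℂ (fun _ : TSite d P => c₀) V').injective
  funext x
  rw [Equiv.apply_symm_apply, equiv_covDivL2K, equiv_covDivL2K, covDiv_apply, covDiv_apply]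
  simp only [adTransportW_inv_one, LinearMap.id_apply, map_sub, map_smul, map_sum, Equiv.apply_symm_apply]

/-- **THE FLAT SITE LAPLACE OPERATOR `Δ^η_1 = D*(1)D(1)` (3.23) IS NATURAL IN THE FIBRE.** [folklore] [cite: Balaban1985BackgroundPropagators, (3.23) p.394] -/
theorem map_covLaplaceSiteK_one (l : SiteL2K ℂ d P c₀ V) :
    (WL2.equiv ℂ _ V').symm (fun x => ψ (WL2.equiv ℂ _ V
        (covLaplaceSiteK (c₀ := c₀) c (adTransportW φ (fun _ : Bond d P => (1 : 𝔸ˣ))) (adTransportW φ fun _ : Bond d P => (1 : 𝔸ˣ)⁻¹) l) x)) =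
      covLaplaceSiteK (c₀ := c₀) c (adTransportW φ' (fun _ : Bond d P => (1 : 𝔸'ˣ))) (adTransportW φ' fun _ : Bond d P => (1 : 𝔸'ˣ)⁻¹)
        ((WL2.equiv ℂ _ V').symm fun x => ψ (WL2.equiv ℂ _ V l x)) := by
  unfold covLaplaceSiteK
  rw [LinearMap.comp_apply, LinearMap.comp_apply, map_covDivL2K_one φ φ' ψ, map_covDerivL2K_one φ φ' ψ]

end FlatLetters

/-! ## §3 The flat averaging letters `Q′(1)`, `Q(1)` commute with every linear map of the fibre (and do not see `φ`) -/

section Averaging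

open B7Prop1Explicit (U1 Wcx boxVec)
open B9Eq319QprimeTorus (fineP)
open B9Eq326OperatorAssembly (QprimeW)
open B9Eq315QTorus (perSite perCfg cornerSite QtorusW QtorusW_apply)
open B5Eq155FlatAveragingCommute (QprimeW_one_apply)
open B9Eq315QFlatNorm (QtorusLin_one_apply)

variable (L : ℕ) [NeZero L] (m : Fin d → ℕ) [∀ i, NeZero (fineP L m i)] (hL : 1 ≤ L) {c₀ c₁ : ℝ} [Fact (0 < c₀)] [Fact (0 < c₁)]
  {𝔸 : Type*} [NormedRing 𝔸] [NormedAlgebra ℂ 𝔸] [CompleteSpace 𝔸] [NormOneClass 𝔸]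
  {V : Type*} [NormedAddCommGroup V] [InnerProductSpace ℂ V] (φ : V ≃ₗ[ℂ] 𝔸)
  {α : ℝ} (hα1 : α ≤ 1 / 64)
  (hU1 : ∀ (x : B7Prop1Explicit.Site d) (κ : Fin d), perCfg (fineP L m) (fun _ : Bond d (fineP L m) => (1 : 𝔸ˣ)) x κ ∈ U1 𝔸)
  (hreg : ∀ (y : TSite d m) (κ : Fin d) (r : Fin d → Fin L),
    ‖((Wcx L (perCfg (fineP L m) (fun _ : Bond d (fineP L m) => (1 : 𝔸ˣ))) (cornerSite L y) κ (boxVec L r) : 𝔸ˣ) : 𝔸) - 1‖ ≤ α)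
  {𝔸' : Type*} [NormedRing 𝔸'] [NormedAlgebra ℂ 𝔸'] [CompleteSpace 𝔸'] [NormOneClass 𝔸']
  {V' : Type*} [NormedAddCommGroup V'] [InnerProductSpace ℂ V'] (φ' : V' ≃ₗ[ℂ] 𝔸')
  {α' : ℝ} (hα1' : α' ≤ 1 / 64)
  (hU1' : ∀ (x : B7Prop1Explicit.Site d) (κ : Fin d), perCfg (fineP L m) (fun _ : Bond d (fineP L m) => (1 : 𝔸'ˣ)) x κ ∈ U1 𝔸')
  (hreg' : ∀ (y : TSite d m) (κ : Fin d) (r : Fin d → Fin L),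
    ‖((Wcx L (perCfg (fineP L m) (fun _ : Bond d (fineP L m) => (1 : 𝔸'ˣ))) (cornerSite L y) κ (boxVec L r) : 𝔸'ˣ) : 𝔸') - 1‖ ≤ α')
  (ψ : V →ₗ[ℂ] V')

omit [∀ i, NeZero (fineP L m i)] [Fact (0 < c₀)] [CompleteSpace 𝔸] [NormOneClass 𝔸] [CompleteSpace 𝔸'] [NormOneClass 𝔸'] in
/-- **THE FLAT `Q′(1)` (the plain block mean, (3.19) at `V = 1`) IS NATURAL IN THE FIBRE** — and independent of the algebra reading `φ`.
[cite: Balaban1985BackgroundPropagators, (3.19) p.393; Balaban1985Averaging, p.27] -/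
theorem map_QprimeW_one (l : SiteL2K ℂ d (fineP L m) c₀ V) (y : TSite d m) :
    ψ (QprimeW L m φ (fun _ : Bond d (fineP L m) => (1 : 𝔸ˣ)) l y) =
      QprimeW L m φ' (fun _ : Bond d (fineP L m) => (1 : 𝔸'ˣ)) (c₀ := c₀)
        ((WL2.equiv ℂ (fun _ : TSite d (fineP L m) => c₀) V').symm fun x => ψ (WL2.equiv ℂ _ V l x)) y := by
  rw [QprimeW_one_apply, QprimeW_one_apply, map_sum]
  refine Finset.sum_congr rfl fun x _ => ?_
  rw [LinearMap.map_smul_of_tower, Equiv.apply_symm_apply]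

omit [NeZero L] [Fact (0 < c₀)] [Fact (0 < c₁)] in
/-- **THE FLAT `Q(1)` ON THE WEIGHTED CARRIER DOES NOT SEE `φ`**: `(Q(1)f)(y, κ) = L^{−(d+1)}·Σ_r Σ_{i<L} f((L·y + r + ie_κ) mod L·m, κ)` for
`W`-valued `f` ([B7] (125) at `V₀ = 1`, `B9Eq315QFlatNorm.QtorusLin_one_apply`, conjugated by the linear `φ`).
[cite: Balaban1985Averaging, (125) p.36; Balaban1985BackgroundPropagators, (3.15) p.393] -/
theorem equiv_QtorusW_one (f : BondL2K ℂ d (fineP L m) c₀ V) (c : Bond d m) :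
    WL2.equiv ℂ _ V (QtorusW L m hL φ (fun _ => 1) hα1 hU1 hreg (c₁ := c₁) f) c =
      (((L : ℝ) ^ (d + 1))⁻¹ : ℝ) • ∑ r : Fin d → Fin L, ∑ i ∈ Finset.range L,
        WL2.equiv ℂ _ V f (perSite (fineP L m) (cornerSite L c.1 + boxVec L r + (i : ℤ) • B7Prop1Explicit.e c.2), c.2) := by
  rw [QtorusW_apply, QtorusLin_one_apply L m hL hα1 hU1 hreg, RCLike.real_smul_eq_coe_smul (K := ℂ), map_smul, map_sum,
    RCLike.real_smul_eq_coe_smul (K := ℂ)]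
  congr 1
  refine Finset.sum_congr rfl fun r _ => ?_
  rw [map_sum]
  exact Finset.sum_congr rfl fun i _ => φ.symm_apply_apply _

omit [NeZero L] [Fact (0 < c₀)] [Fact (0 < c₁)] in
/-- **THE FLAT `Q(1)` IS NATURAL IN THE FIBRE**: `ψ ∘ Q(1) = Q(1) ∘ ψ`, whatever the algebra readings `φ`, `φ′` and the flat regularity letters
on the two sides. [cite: Balaban1985Averaging, (125) p.36; Balaban1985BackgroundPropagators, (3.15) p.393] -/
theorem map_QtorusW_one (f : BondL2K ℂ d (fineP L m) c₀ V) :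
    (WL2.equiv ℂ (fun _ : Bond d m => c₁) V').symm
        (fun c => ψ (WL2.equiv ℂ _ V (QtorusW L m hL φ (fun _ => 1) hα1 hU1 hreg (c₁ := c₁) f) c)) =
      QtorusW L m hL φ' (fun _ => 1) hα1' hU1' hreg' (c₁ := c₁)
        ((WL2.equiv ℂ (fun _ : Bond d (fineP L m) => c₀) V').symm fun b => ψ (WL2.equiv ℂ _ V f b)) := by
  apply (WL2.equiv ℂ (fun _ : Bond d m => c₁) V').injective
  funext c
  rw [Equiv.apply_symm_apply, equiv_QtorusW_one L m hL φ hα1 hU1 hreg, equiv_QtorusW_one L m hL φ' hα1' hU1' hreg',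
    LinearMap.map_smul_of_tower, map_sum]
  congr 1
  refine Finset.sum_congr rfl fun r _ => ?_
  rw [map_sum]
  exact Finset.sum_congr rfl fun i _ => (Equiv.apply_symm_apply _ _).symm ▸ rfl

end Averaging

/-! ## §4 The flat projection `R(1)` onto `Δ^η_1 N(Q′(1))` commutes with the fibre coordinates -/

section Projection

variable {E E' : Type*} [NormedAddCommGroup E] [InnerProductSpace ℂ E] [FiniteDimensional ℂ E]
  [NormedAddCommGroup E'] [InnerProductSpace ℂ E'] [FiniteDimensional ℂ E']
  {F F' : Type*} [AddCommGroup F] [Module ℂ F] [AddCommGroup F'] [Module ℂ F']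

/-- **AN ORTHOGONAL PROJECTION OF THE SHAPE (3.21) COMMUTES WITH AN INTERTWINING ADJOINT PAIR**: if `Ψ : E → E′`, `Ψ′ : E′ → E` are mutually
adjoint, `Ψ` intertwines `Δ, Δ′` and maps `N(Q)` into `N(Q′)`, and `Ψ′` intertwines `Δ′, Δ` and maps `N(Q′)` into `N(Q)`, then `Ψ′ ∘ R′ = R ∘ Ψ′`
for the orthogonal projections `R`, `R′` onto `Δ N(Q)`, `Δ′ N(Q′)` (membership + orthogonality characterisation of the projection). [folklore]
[cite: Balaban1985BackgroundPropagators, (3.21)–(3.22) p.394] -/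
theorem map_projR_of_intertwine (Δ : E →ₗ[ℂ] E) (Q : E →ₗ[ℂ] F) (Δ' : E' →ₗ[ℂ] E') (Q' : E' →ₗ[ℂ] F') (Ψ : E →ₗ[ℂ] E') (Ψ' : E' →ₗ[ℂ] E)
    (hadj : ∀ (g : E) (f : E'), ⟪g, Ψ' f⟫_ℂ = ⟪Ψ g, f⟫_ℂ) (hΔ : ∀ g, Ψ (Δ g) = Δ' (Ψ g)) (hΔ' : ∀ f, Ψ' (Δ' f) = Δ (Ψ' f))
    (hQ : ∀ g, Q g = 0 → Q' (Ψ g) = 0) (hQ' : ∀ f, Q' f = 0 → Q (Ψ' f) = 0) (v : E') :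
    Ψ' (projR Δ' Q' v) = projR Δ Q (Ψ' v) := by
  haveI : CompleteSpace ((LinearMap.ker Q).map Δ) := FiniteDimensional.complete ℂ _
  haveI : CompleteSpace ((LinearMap.ker Q').map Δ') := FiniteDimensional.complete ℂ _
  obtain ⟨n', hn', hp⟩ := exists_ker_projR_eq Δ' Q' v
  symm
  show ((LinearMap.ker Q).map Δ).starProjection (Ψ' v) = Ψ' (projR Δ' Q' v)
  refine Submodule.eq_starProjection_of_mem_of_inner_eq_zero ?_ fun s hs => ?_
  · rw [hp, hΔ']
    exact Submodule.mem_map_of_mem (LinearMap.mem_ker.2 (hQ' n' hn'))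
  · obtain ⟨n, hn, rfl⟩ := Submodule.mem_map.1 hs
    rw [← map_sub, ← inner_conj_symm, hadj, inner_conj_symm, hΔ]
    exact Submodule.starProjection_inner_eq_zero v _ (Submodule.mem_map_of_mem (LinearMap.mem_ker.2 (hQ n (LinearMap.mem_ker.1 hn))))

end Projection

section ProjectionFlat

open B7Prop1Explicit (U1 Wcx boxVec)
open B9Eq319QprimeTorus (fineP)
open B9Eq326OperatorAssembly (QprimeW RofU)
open B9Eq315QTorus (perCfg cornerSite)

variable (L : ℕ) [NeZero L] (m : Fin d → ℕ) {c₀ : ℝ} [Fact (0 < c₀)]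
  {𝔸 : Type*} [NormedRing 𝔸] [NormedAlgebra ℂ 𝔸]
  {W : Type*} [NormedAddCommGroup W] [InnerProductSpace ℂ W] [FiniteDimensional ℂ W] (φ : W ≃ₗ[ℂ] 𝔸) (η : ℝ)

/-- **THE FLAT PROJECTION `R(1)` (3.21) COMMUTES WITH THE FIBRE COORDINATES**: `⟨u, (R(1)v)(·)⟩ = R(1)⟨u, v(·)⟩` — the `W`-valued `R(1)` of the
chain (any algebra reading `φ`) against the scalar one (`𝔸 = ℂ`, `φ = refl`); §4's lemma at the adjoint pair `⟨u, ·⟩` ∕ `(·)•u` (§1), the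
intertwinings being §2's `map_covLaplaceSiteK_one` and §3's `map_QprimeW_one` in the two directions.
[cite: Balaban1985BackgroundPropagators, (3.21)–(3.23) p.394] -/
theorem coord_RofU_one (u : W) (v : SiteL2K ℂ d (fineP L m) c₀ W) :
    (WL2.equiv ℂ (fun _ : TSite d (fineP L m) => c₀) ℂ).symm
        (fun x => ⟪u, WL2.equiv ℂ _ W (RofU L m φ η (fun _ : Bond d (fineP L m) => (1 : 𝔸ˣ)) v) x⟫_ℂ) =
      RofU L m (LinearEquiv.refl ℂ ℂ) η (fun _ : Bond d (fineP L m) => (1 : ℂˣ))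
        ((WL2.equiv ℂ (fun _ : TSite d (fineP L m) => c₀) ℂ).symm fun x => ⟪u, WL2.equiv ℂ _ W v x⟫_ℂ) := by
  unfold RofU RLatticeK
  have key := map_projR_of_intertwine
    (covLaplaceSiteK (c₀ := c₀) ((η : ℂ))⁻¹ (adTransportW (LinearEquiv.refl ℂ ℂ) (fun _ : Bond d (fineP L m) => (1 : ℂˣ)))
      (adTransportW (LinearEquiv.refl ℂ ℂ) fun _ : Bond d (fineP L m) => (1 : ℂˣ)⁻¹))
    (QprimeW L m (LinearEquiv.refl ℂ ℂ) (fun _ : Bond d (fineP L m) => (1 : ℂˣ)) (c₀ := c₀))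
    (covLaplaceSiteK (c₀ := c₀) ((η : ℂ))⁻¹ (adTransportW φ (fun _ : Bond d (fineP L m) => (1 : 𝔸ˣ)))
      (adTransportW φ fun _ : Bond d (fineP L m) => (1 : 𝔸ˣ)⁻¹))
    (QprimeW L m φ (fun _ : Bond d (fineP L m) => (1 : 𝔸ˣ)) (c₀ := c₀))
    ((WL2.linearEquiv ℂ ℂ (fun _ : TSite d (fineP L m) => c₀)).symm.toLinearMap ∘ₗ
      (LinearMap.toSpanSingleton ℂ W u).compLeft (TSite d (fineP L m)) ∘ₗ
        (WL2.linearEquiv ℂ ℂ (fun _ : TSite d (fineP L m) => c₀)).toLinearMap)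
    ((WL2.linearEquiv ℂ ℂ (fun _ : TSite d (fineP L m) => c₀)).symm.toLinearMap ∘ₗ
      (innerₛₗ ℂ u : W →ₗ[ℂ] ℂ).compLeft (TSite d (fineP L m)) ∘ₗ
        (WL2.linearEquiv ℂ ℂ (fun _ : TSite d (fineP L m) => c₀)).toLinearMap)
    (fun g f => (inner_coord_eq_inner_tensor u g f).trans rfl)
    (fun g => (map_covLaplaceSiteK_one (LinearEquiv.refl ℂ ℂ) φ (LinearMap.toSpanSingleton ℂ W u) _ g).symm ▸ rfl)
    (fun f => (map_covLaplaceSiteK_one φ (LinearEquiv.refl ℂ ℂ) (innerₛₗ ℂ u : W →ₗ[ℂ] ℂ) _ f).symm ▸ rfl)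
    (fun g hg => by
      funext y
      have h := map_QprimeW_one L m (LinearEquiv.refl ℂ ℂ) φ (LinearMap.toSpanSingleton ℂ W u) g y
      rw [hg, Pi.zero_apply, map_zero] at h
      exact h ▸ rfl)
    (fun f hf => by
      funext y
      have h := map_QprimeW_one L m φ (LinearEquiv.refl ℂ ℂ) (innerₛₗ ℂ u : W →ₗ[ℂ] ℂ) f y
      rw [hf, Pi.zero_apply, map_zero] at h
      exact h ▸ rfl)
    v
  exact key

end ProjectionFlat

/-! ### The letters against the coordinate functional `⟨u, ·⟩` (scalar side `𝔸 = ℂ`, `φ = refl`) -/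

section CoordLetters

open B7Prop1Explicit (U1 Wcx boxVec)
open B9Eq319QprimeTorus (fineP)
open B9Eq315QTorus (perCfg cornerSite QtorusW)

variable (L : ℕ) (m : Fin d → ℕ) [∀ i, NeZero (fineP L m i)] (hL : 1 ≤ L) {c₀ c₁ : ℝ} [Fact (0 < c₀)] [Fact (0 < c₁)]
  {𝔸 : Type*} [NormedRing 𝔸] [NormedAlgebra ℂ 𝔸] [CompleteSpace 𝔸] [NormOneClass 𝔸]
  {W : Type*} [NormedAddCommGroup W] [InnerProductSpace ℂ W] (φ : W ≃ₗ[ℂ] 𝔸)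
  {α : ℝ} (hα1 : α ≤ 1 / 64)
  (hU1 : ∀ (x : B7Prop1Explicit.Site d) (κ : Fin d), perCfg (fineP L m) (fun _ : Bond d (fineP L m) => (1 : 𝔸ˣ)) x κ ∈ U1 𝔸)
  (hreg : ∀ (y : TSite d m) (κ : Fin d) (r : Fin d → Fin L),
    ‖((Wcx L (perCfg (fineP L m) (fun _ : Bond d (fineP L m) => (1 : 𝔸ˣ))) (cornerSite L y) κ (boxVec L r) : 𝔸ˣ) : 𝔸) - 1‖ ≤ α)
  {α' : ℝ} (hα1' : α' ≤ 1 / 64)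
  (hU1' : ∀ (x : B7Prop1Explicit.Site d) (κ : Fin d), perCfg (fineP L m) (fun _ : Bond d (fineP L m) => (1 : ℂˣ)) x κ ∈ U1 ℂ)
  (hreg' : ∀ (y : TSite d m) (κ : Fin d) (r : Fin d → Fin L),
    ‖((Wcx L (perCfg (fineP L m) (fun _ : Bond d (fineP L m) => (1 : ℂˣ))) (cornerSite L y) κ (boxVec L r) : ℂˣ) : ℂ) - 1‖ ≤ α')
  (c : ℂ) (u : W)

omit [∀ i, NeZero (fineP L m i)] [CompleteSpace 𝔸] [NormOneClass 𝔸] in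
/-- §2's `map_covCurlL2K_one` at the coordinate functional `⟨u, ·⟩`. [cite: Balaban1985BackgroundPropagators, (3.4) p.391] -/
theorem coord_covCurlL2K_one (A : BondL2K ℂ d (fineP L m) c₀ W) :
    (WL2.equiv ℂ (fun _ : B9SectCLatticeCarrier.Plaq d (fineP L m) => c₀) ℂ).symm
        (fun p => ⟪u, WL2.equiv ℂ _ W (covCurlL2K ℂ c₀ c (adTransportW φ (fun _ : Bond d (fineP L m) => (1 : 𝔸ˣ))) A) p⟫_ℂ) =
      covCurlL2K ℂ c₀ c (adTransportW (LinearEquiv.refl ℂ ℂ) (fun _ : Bond d (fineP L m) => (1 : ℂˣ)))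
        ((WL2.equiv ℂ (fun _ : Bond d (fineP L m) => c₀) ℂ).symm fun b => ⟪u, WL2.equiv ℂ _ W A b⟫_ℂ) :=
  map_covCurlL2K_one φ (LinearEquiv.refl ℂ ℂ) (innerₛₗ ℂ u) c A

omit [∀ i, NeZero (fineP L m i)] [CompleteSpace 𝔸] [NormOneClass 𝔸] in
/-- §2's `map_covDivL2K_one` at the coordinate functional `⟨u, ·⟩`. [cite: Balaban1985BackgroundPropagators, (3.8) p.392] -/
theorem coord_covDivL2K_one (A : BondL2K ℂ d (fineP L m) c₀ W) :
    (WL2.equiv ℂ (fun _ : TSite d (fineP L m) => c₀) ℂ).symm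
        (fun x => ⟪u, WL2.equiv ℂ _ W (covDivL2K ℂ c₀ c (adTransportW φ fun _ : Bond d (fineP L m) => (1 : 𝔸ˣ)⁻¹) A) x⟫_ℂ) =
      covDivL2K ℂ c₀ c (adTransportW (LinearEquiv.refl ℂ ℂ) fun _ : Bond d (fineP L m) => (1 : ℂˣ)⁻¹)
        ((WL2.equiv ℂ (fun _ : Bond d (fineP L m) => c₀) ℂ).symm fun b => ⟪u, WL2.equiv ℂ _ W A b⟫_ℂ) :=
  map_covDivL2K_one φ (LinearEquiv.refl ℂ ℂ) (innerₛₗ ℂ u) c A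

omit [Fact (0 < c₀)] [Fact (0 < c₁)] in
/-- §3's `map_QtorusW_one` at the coordinate functional `⟨u, ·⟩`. [cite: Balaban1985BackgroundPropagators, (3.15) p.393] -/
theorem coord_QtorusW_one [NeZero L] (f : BondL2K ℂ d (fineP L m) c₀ W) :
    (WL2.equiv ℂ (fun _ : Bond d m => c₁) ℂ).symm
        (fun c => ⟪u, WL2.equiv ℂ _ W (QtorusW L m hL φ (fun _ => 1) hα1 hU1 hreg (c₁ := c₁) f) c⟫_ℂ) =
      QtorusW L m hL (LinearEquiv.refl ℂ ℂ) (fun _ => 1) hα1' hU1' hreg' (c₁ := c₁)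
        ((WL2.equiv ℂ (fun _ : Bond d (fineP L m) => c₀) ℂ).symm fun b => ⟪u, WL2.equiv ℂ _ W f b⟫_ℂ) :=
  map_QtorusW_one L m hL φ hα1 hU1 hreg (LinearEquiv.refl ℂ ℂ) hα1' hU1' hreg' (innerₛₗ ℂ u) f

end CoordLetters

end Literature.MathematicalPhysics.QuantumFieldTheory.Balaban1983to89.B5Eq172FlatFibreNaturality

end
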